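import Literature.MathematicalPhysics.QuantumFieldTheory.Balaban1983to89.B9Thm310CommutatorSum
import Literature.MathematicalPhysics.QuantumFieldTheory.Balaban1983to89.B9Thm37CutoffGradTerms
import Literature.MathematicalPhysics.QuantumFieldTheory.Balaban1983to89.B9Thm37TransposedCommutator
import Literature.MathematicalPhysics.QuantumFieldTheory.Balaban1983to89.B9Eq3105Coords
import Literature.MathematicalPhysics.QuantumFieldTheory.Balaban1983to89.Node00.OpsYBondLift

/-!
# `Balaban1983to89.B9Thm310CutoffLapTermsB` — T. Bałaban, *Propagators for lattice gauge theories in a background field*, Commun. Math. Phys. **99** (1985)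
# 389–434 [Balaban1985BackgroundPropagators], (3.100) p. 413 applied twice + Thm 3.3 (3.42)₄ pp. 397∕399: the LAPLACIAN cube term `Δ_U(h_□G_□(U)h_□)` on the
# BOND sector — `‖(Δ_U(h_□·G_□(U)(h_□Λ)))(b)‖ ≤ B₀(1 + (d+1)((5∕8)(C1F∕M_h)(e^{δ}+1) + (25∕64)C2F∕M_h²))·e^{−δd(y,y′)}|J|` — and its localized block majorant
# summed over the cover: the `hTL`∕`hKL` input of FILE 2-B `B9Thm310GTorusRegularEntries` ∕ FILE 6-B at the cube cover of record (sub-row G-B9-LETTERS, M5.7 FILE 4c-B,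
# the bond twin of p21's `B9Thm37CutoffGradTerms` §2 `norm_lapS_hOh_le`)

statement-level skeleton of published theorems with citation tags; proofs where landed; nothing here is a claim about the Yang–Mills mass gap

PDF held: `paper:balaban1985-cmp99-background-propagators` (journal page = PDF page + 388); pp. 392, 395, 397, 399, 409, 413–414 read from the held text layer; [4] =
[Balaban1984PropagatorsII] (2.44) p. 230, p. 234.

THE PRINT.  p. 413 (3.100) «(D_U(hA))(b) = h(b₋)(D_UA)(b) + …, similarly for adjoint derivatives»; p. 414 l.1–2 «first order differential operators with coefficients
determined by derivatives of the function h. They are of the order O(M⁻¹), or O(M⁻²), if considered on a proper scale»; (3.23) p. 395 `Δ_U = Σ_μ D*_{U,μ}D_{U,μ}`;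
p. 397 (3.42)₄ «|(Δ_UG′(U)λ)(x)| ≦ B₀e^{−δ₀d(y,y′)}|λ|»; p. 399 Thm 3.3; p. 409 (3.87).

WHY THIS FILE (cell context: G-B9-LETTERS M5.7; FILE 2-B ∕ 6-B display per cube the block majorant `hTL □` of `conj b(Δ_U)·(h_□·conj b G_□(U)·h_□)` and the summed
bound `hKL`; siblings FILE 4a-B `B9Thm310CutoffGradTermsB` (forward gradient) and FILE 4b-B `B9Thm310CutoffDivTermsB` (right entry)).  Composing p38's two Leibniz rules
(3.100) (`cdB_cutMulY_apply`, `cdsB_cutMulY_apply`) gives, per direction `μ` and bond `b` (`z = b₋`, `z± = b₋ ± e_μ`, `b± = ⟨z±, ν⟩`),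
`(∇*_μ∇_μ(hA))(b) = h(z)(∇*_μ∇_μA)(b) + c_f(h(z⁻) − h(z))R(U_μ(z⁻))⁻¹(∇_μA)(b⁻) − c_f(h(z⁺) − h(z))(∇_μA)(b) − c_f²(h(z⁺) − 2h(z) + h(z⁻))A(b)`
(§1 `cdsB_cdB_cutMulY_apply`, an identity in the `ℂ`-module; `R(u)⁻¹R(u) = 1`), hence `Δ_U(hA) = hΔ_UA + Σ_μ(…)` (`lapB_cutMulY_apply`).  With `A = O(h_□Λ)` for the cube
letter `O` and `Λ` in the class of `J` (`supp J ⊂ Δ(βy′)`), at `b ∈ Δ(βy)`: the main term by (3.42)₄ (`h342₃`), the two first-order terms by (3.42)₂ (`h342₁`) at `b`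
and at the neighbour `b⁻` (block within one admissible bond: `e^{−δd(y₁,y′)} ≤ e^{δ}e^{−δd(y,y′)}`), the zeroth-order term by (3.42)₁ (`h342₀`); the coefficients are
print's «O(M⁻¹)», «O(M⁻²)»: `|c_f|·|∂h_□|·ℓ = κ₁L^{lev} ≤ (5∕8)C1F∕M_h` and `c_f²|∂²h_□|ℓ(y)² = κ₂L^{2·lev z} ≤ (25∕64)C2F∕M_h²` (`κ₁ = C1F∕(8S_j∕5)`, `κ₂ = C2F∕(8S_j∕5)²`,
p38's `abs_hTY_shiftY_sub_le` ∕ p21's `abs_hTY_second_diff_le`), because every non-vanishing coefficient puts its point within one site of `supp h_□`, where `lev ≤ j+1`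
(p21's `mem_QT_and_lev_of_near`) and `|c_f|ℓ(y) = L^{lev z}` (`η = |c_f|⁻¹`).  §3 converts the bound into FILE 2-B's `hTL □` shape at `GACubeY` from the block `hE` on
FILE 3-B's localisation sets and sums the overlap (`hKL`, `N′ = 3·5^{d+1}e^{αδ(2L+4)}c₁(α)`).

WHAT IS PROVED (all `theorem`s, 0 `def`, 0 sorry).  §1 `cdB_apply_eq`, `cdsB_apply_eq`, ★ `cdsB_cdB_cutMulY_apply`, `lapB_cutMulY_apply`, `kappa_pow_le`, `kappa2_pow_le`;
§2 ★★ `norm_lapB_hOh_le`; §3 `lapB_hMul_apply_eq_zero_of_far`, `exists_nearQT_of_lapB_hOh_ne_zero`, ★★ `hasMajorant_conj_lapTermB` (the `hTL □` majorant at `GACubeY`,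
from `hE`), ★★ `sum_lapTermB_majorant_le` (the `hKL` bound, `A₃ = N′·M₂(Σ‖b_j‖)·B₀(1 + (d+1)((5∕8)(C1F∕M_h)(e^{δ}+1) + (25∕64)C2F∕M_h²))`).
HONEST SCOPE.  Displayed: the cube letter's block `hE`, bi-contractivity `hU`, `η = |c_f|⁻¹`, (2.61).  The transposed remainder (`hV`) and families 2–4 of `R` are NOT
treated (PLAN 5 ∕ GAPS G-B9-05–07).  Nothing continuum ∕ OS ∕ mass gap ∕ Clay; YM mass gap NOT proved by any of this (Track A conditional rung).
`--supports stmt-QuantumFields-19200`.  Net new unproved facts: 0.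
-/

noncomputable section

namespace Literature.MathematicalPhysics.QuantumFieldTheory.Balaban1983to89.B9Thm310CutoffLapTermsB

open Node00 B9CubeLettersInvReadings
open B9Thm37CubeCoverCommutators (cutMulY cutMulY_apply hTY)
open B9Thm37CubeCoverCommutatorSizes (side_conditions four_le_P' abs_hTY_shiftY_sub_le abs_hTY_shiftY_symm_sub_le)
open B9Thm37CubeCoverCommutatorSizesGrad (C1F_div_bigSide_eq)
open B9Thm37CommutatorBound389 (norm_cutMulY_le_of_le torusSupNorm_sub_shiftY_le_one dist_blkOf_le_one_of_touch)
open B9Thm37CutoffGradTerms (mem_QT_and_lev_of_near len_eq_pow_mul_eta torusSupNorm_sub_self_le_one)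
open B9Thm37TransposedCommutator (abs_hTY_second_diff_le)
open B9Eq3104CutoffCommutators (hBdY hBdY_apply)
open B9Thm310CommutatorBound389BMajorant (hasMajorant_conj_of_ball_boundB norm_liftY_le_abs)
open B9Thm310CommutatorSum (sum_indicator_nearQT_le)
open B9CubeLettersInvReadDictB (h342₀_of_eBlockInvB h342₁_of_eBlockInvB h342₃_of_eBlockInvB)
open B9CubeLettersBondOpsL0 (GACubeY)
open B9Thm39CinvTorusRegular (conj_cutMulY)
open B9Thm37Sum (mulOp)
open Node00.OpsYBondLift (lapBC lapBC_apply)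
open B6KLevelCensusIndexV1 (KIdx)
open B6Ineq2142KLevelV1 (β)
open B6GlobalChartV1 (PV blkV1)
open B6Geom246MultiLevelBox (bset blkOf)
open B6Geom246MultiLevelTorus (bondT connectedT)
open B6Cover236MultiLevelBlocks (cubes)
open B6MultiLevelBoxOperator (bigSide bigSide_eq)
open B6Partition118KLevelTorus (abs_hT_le_one)
open B6Partition118KLevelTorusCentral (QT blkOf_mem_QT_of_hT_ne_zero)
open B6Partition118KLevelFineSizes (C1F C1F_nonneg)
open B6Partition118KLevelFineSecond (C2F C2F_nonneg)
open B6RandomWalk (HasMajorant Ineq261 hasMajorant_mono)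
open B9Thm34Ext (toB6)
open B9FromB6 (EBlock)
open B9GeoNormsKLevelV1 (geo9K geo9K_supNorm_nonneg)
open B9GeoLemma21KLevelV1 (geo9K_dist_eq)
open B9Ineq349SiteComposite (etaS_pos)
open B9Eq352DivFormLetters (conj)
open B9Eq39Adjoint (R R_smul R_sub R_inv_R)
open B9Eq310Hermitian (norm_R_le)
open Node00.OpsYNablaBridge (chartY shiftY_chartY shiftY_symm_chartY shift_unshift unshift_shift)
open B4TorusKernel.MultiPeriod (torusSupNorm)
open scoped Matrix

variable {𝔸 : Type} [NormedRing 𝔸] [NormedAlgebra ℂ 𝔸] [CompleteSpace 𝔸]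
variable {d ℓ : ℕ} {hd : 1 ≤ d + 1} {hL : Odd (ℓ + 1) ∧ 1 < ℓ + 1} {b₀ b₁ : ℝ}
variable {ι : Type} [Fintype ι]
variable (i : KIdx d ℓ hd hL b₀ b₁) (b : Module.Basis ι ℝ 𝔸)

/-! ## §1 (3.100) twice: the covariant Laplacian through a cut-off; the «O(M⁻¹)», «O(M⁻²)» coefficients -/

section Leibniz

variable (U : CfgY 𝔸 i)

/-- `(∇_{U,μ}A)(b) = c_f·(R(U_μ(b₋))A(⟨b₋+e_μ, ν⟩) − A(b))` (def-Y's `cdB`, unfolded). [cite: Balaban1985BackgroundPropagators, (3.3) p.390, (3.8) p.392] -/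
theorem cdB_apply_eq (μ : Fin (d + 1)) (A : FBondY i → 𝔸) (bd : FBondY i) :
    cdB i U μ A bd = ((i.cf : ℝ) : ℂ) • (R (U μ bd.src) (A ⟨bd.src.shift μ, bd.dir⟩) - A bd) := by
  cases bd; rfl

/-- `(∇*_{U,μ}A)(b) = c_f·(R(U_μ(b₋−e_μ))⁻¹A(⟨b₋−e_μ, ν⟩) − A(b))` (def-Y's `cdsB`, unfolded). [cite: Balaban1985BackgroundPropagators, (3.8) p.392, (3.5) p.391] -/
theorem cdsB_apply_eq (μ : Fin (d + 1)) (A : FBondY i → 𝔸) (bd : FBondY i) :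
    cdsB i U μ A bd = ((i.cf : ℝ) : ℂ) • (R (U μ (bd.src.unshift μ))⁻¹ (A ⟨bd.src.unshift μ, bd.dir⟩) - A bd) := by
  cases bd; rfl

/-- ★ **(3.100) TWICE, PER DIRECTION**: `(∇*_μ∇_μ(hA))(b) = h(z)(∇*_μ∇_μA)(b) + c_f(h(z⁻) − h(z))·R(U_μ(z⁻))⁻¹(∇_μA)(b⁻) − c_f(h(z⁺) − h(z))·(∇_μA)(b) − c_f²(h(z⁺) − 2h(z) + h(z⁻))·A(b)`,
`z = b₋`, `z± = b₋ ± e_μ`, `b⁻ = ⟨z⁻, ν⟩` — the first-order terms «O(M⁻¹)» and the second-difference term «O(M⁻²)» of p. 414 l.1–2.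
[cite: Balaban1985BackgroundPropagators, (3.100) p.413 (and «similarly for adjoint derivatives»), p.414 l.1–2, (3.8) p.392] -/
theorem cdsB_cdB_cutMulY_apply (μ : Fin (d + 1)) (h : SiteY i → ℝ) (A : FBondY i → 𝔸) (bd : FBondY i) :
    cdsB i U μ (cdB i U μ (cutMulY (hBdY i h) A)) bd
      = ((h (chartY i bd.src) : ℝ) : ℂ) • cdsB i U μ (cdB i U μ A) bd
        + ((i.cf * (h (chartY i (bd.src.unshift μ)) - h (chartY i bd.src)) : ℝ) : ℂ) •
            R (U μ (bd.src.unshift μ))⁻¹ (cdB i U μ A ⟨bd.src.unshift μ, bd.dir⟩)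
        - ((i.cf * (h (chartY i (bd.src.shift μ)) - h (chartY i bd.src)) : ℝ) : ℂ) • cdB i U μ A bd
        - ((i.cf ^ 2 * (h (chartY i (bd.src.shift μ)) - 2 * h (chartY i bd.src) + h (chartY i (bd.src.unshift μ))) : ℝ) : ℂ) • A bd := by
  have eb : (⟨bd.src, bd.dir⟩ : FBondY i) = bd := rfl
  simp only [cdsB_apply_eq, cdB_apply_eq, cutMulY_apply, hBdY_apply, shift_unshift, R_smul, R_sub, R_inv_R, smul_sub, smul_smul, eb]
  push_cast
  module

/-- **`Δ_U(hA) = hΔ_UA + Σ_μ(first-order and second-difference terms)`** — `cdsB_cdB_cutMulY_apply` summed over the directions ((3.23): `Δ_U = Σ_μ∇*_μ∇_μ`).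
[cite: Balaban1985BackgroundPropagators, (3.23) p.395, (3.100) p.413, p.414 l.1–2] -/
theorem lapB_cutMulY_apply (h : SiteY i → ℝ) (A : FBondY i → 𝔸) (bd : FBondY i) :
    lapB i U (cutMulY (hBdY i h) A) bd
      = ((h (chartY i bd.src) : ℝ) : ℂ) • lapB i U A bd
        + ∑ μ : Fin (d + 1),
          (((i.cf * (h (chartY i (bd.src.unshift μ)) - h (chartY i bd.src)) : ℝ) : ℂ) •
              R (U μ (bd.src.unshift μ))⁻¹ (cdB i U μ A ⟨bd.src.unshift μ, bd.dir⟩)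
            - ((i.cf * (h (chartY i (bd.src.shift μ)) - h (chartY i bd.src)) : ℝ) : ℂ) • cdB i U μ A bd
            - ((i.cf ^ 2 * (h (chartY i (bd.src.shift μ)) - 2 * h (chartY i bd.src) + h (chartY i (bd.src.unshift μ))) : ℝ) : ℂ) • A bd) := by
  have e1 : lapB i U (cutMulY (hBdY i h) A) bd = ∑ μ : Fin (d + 1), cdsB i U μ (cdB i U μ (cutMulY (hBdY i h) A)) bd := rfl
  have e2 : lapB i U A bd = ∑ μ : Fin (d + 1), cdsB i U μ (cdB i U μ A) bd := rfl
  rw [e1, e2, Finset.smul_sum, ← Finset.sum_add_distrib]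
  refine Finset.sum_congr rfl fun μ _ => ?_
  rw [cdsB_cdB_cutMulY_apply]
  abel

end Leibniz

section Coeff

/-- «O(M⁻¹)»: `κ₁·L^{lev u} ≤ (5∕8)C1F∕M_h` for `lev u ≤ j + 1` (`κ₁ = C1F∕(8S_j∕5)`, `S_j = M_hL^{j+1}`; p21's bookkeeping).
[cite: Balaban1984PropagatorsII, (2.44) p.230; Balaban1985BackgroundPropagators, p.414 l.1–2] -/
theorem kappa_pow_le (c : ↥(cubes i.D.toDomains)) {u : SiteY i} (hnear : levY i u ≤ c.1.1 + 1) :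
    C1F d ℓ / (8 / 5 * (bigSide ℓ i.Mh c.1.1 : ℝ)) * ((ℓ : ℝ) + 1) ^ levY i u ≤ 5 / 8 * C1F d ℓ / i.Mh := by
  obtain ⟨_, hMh2, _, _⟩ := side_conditions i
  have hL1 : (1 : ℝ) ≤ (ℓ : ℝ) + 1 := by linarith [(Nat.cast_nonneg ℓ : (0 : ℝ) ≤ ℓ)]
  have hM : (0 : ℝ) < i.Mh := by exact_mod_cast (lt_of_lt_of_le (by norm_num) hMh2)
  have hC : 0 ≤ C1F d ℓ := C1F_nonneg d ℓ
  rw [C1F_div_bigSide_eq i c.1.1]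
  have hLj : (0 : ℝ) < ((ℓ : ℝ) + 1) ^ c.1.1 := pow_pos (by linarith) _
  have hq : (((ℓ : ℝ) + 1) ^ c.1.1)⁻¹ * ((ℓ : ℝ) + 1) ^ levY i u ≤ (ℓ : ℝ) + 1 := by
    rw [inv_mul_le_iff₀ hLj]
    calc ((ℓ : ℝ) + 1) ^ levY i u ≤ ((ℓ : ℝ) + 1) ^ (c.1.1 + 1) := pow_le_pow_right₀ hL1 hnear
      _ = ((ℓ : ℝ) + 1) ^ c.1.1 * ((ℓ : ℝ) + 1) := pow_succ _ _
  calc 5 / 8 * C1F d ℓ / (((ℓ : ℝ) + 1) * i.Mh) * (((ℓ : ℝ) + 1) ^ c.1.1)⁻¹ * ((ℓ : ℝ) + 1) ^ levY i u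
      = 5 / 8 * C1F d ℓ / (((ℓ : ℝ) + 1) * i.Mh) * ((((ℓ : ℝ) + 1) ^ c.1.1)⁻¹ * ((ℓ : ℝ) + 1) ^ levY i u) := by ring
    _ ≤ 5 / 8 * C1F d ℓ / (((ℓ : ℝ) + 1) * i.Mh) * ((ℓ : ℝ) + 1) := mul_le_mul_of_nonneg_left hq (by positivity)
    _ = 5 / 8 * C1F d ℓ / i.Mh := by field_simp

/-- «O(M⁻²)»: `κ₂·L^{2·lev u} ≤ (25∕64)C2F∕M_h²` for `lev u ≤ j + 1` (`κ₂ = C2F∕(8S_j∕5)²`). [cite: Balaban1985BackgroundPropagators, p.414 l.1–2; Balaban1984PropagatorsII, (2.44) p.230] -/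
theorem kappa2_pow_le (c : ↥(cubes i.D.toDomains)) {u : SiteY i} (hnear : levY i u ≤ c.1.1 + 1) :
    C2F d ℓ / (8 / 5 * (bigSide ℓ i.Mh c.1.1 : ℝ)) ^ 2 * (((ℓ : ℝ) + 1) ^ levY i u) ^ 2 ≤ 25 / 64 * C2F d ℓ / i.Mh ^ 2 := by
  obtain ⟨_, hMh2, _, _⟩ := side_conditions i
  have hL1 : (1 : ℝ) ≤ (ℓ : ℝ) + 1 := by linarith [(Nat.cast_nonneg ℓ : (0 : ℝ) ≤ ℓ)]
  have hM : (0 : ℝ) < i.Mh := by exact_mod_cast (lt_of_lt_of_le (by norm_num) hMh2)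
  have hC : 0 ≤ C2F d ℓ := C2F_nonneg d ℓ
  have hS : (bigSide ℓ i.Mh c.1.1 : ℝ) = ((ℓ : ℝ) + 1) ^ (c.1.1 + 1) * (i.Mh : ℝ) := by
    rw [bigSide_eq]; push_cast; ring
  have hS0 : 0 < (bigSide ℓ i.Mh c.1.1 : ℝ) := by rw [hS]; positivity
  have hpow : ((ℓ : ℝ) + 1) ^ levY i u ≤ ((ℓ : ℝ) + 1) ^ (c.1.1 + 1) := pow_le_pow_right₀ hL1 hnear
  have hq : (((ℓ : ℝ) + 1) ^ levY i u) ^ 2 ≤ (((ℓ : ℝ) + 1) ^ (c.1.1 + 1)) ^ 2 := pow_le_pow_left₀ (by positivity) hpow 2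
  rw [div_mul_eq_mul_div, hS, div_le_div_iff₀ (by positivity) (by positivity)]
  calc C2F d ℓ * (((ℓ : ℝ) + 1) ^ levY i u) ^ 2 * (i.Mh : ℝ) ^ 2
      ≤ C2F d ℓ * (((ℓ : ℝ) + 1) ^ (c.1.1 + 1)) ^ 2 * (i.Mh : ℝ) ^ 2 := by
        exact mul_le_mul_of_nonneg_right (mul_le_mul_of_nonneg_left hq hC) (by positivity)
    _ = _ := by ring

end Coeff

/-! ## §2 The Laplacian cube term, pointwise: `Δ_U(h_□·O(h_□Λ))` -/

section Lap

variable (U : CfgY 𝔸 i) (O : (FBondY i → 𝔸) →ₗ[ℂ] (FBondY i → 𝔸)) {B₀ δ : ℝ}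

/-- ★★ **THE LAPLACIAN OF A LOCALIZED CUBE PROPAGATOR TERM, BOND SECTOR**: for a bond cube letter `O` with its (3.42) entries over the class DISPLAYED (`h342₀`: first member;
`h342₁`: second; `h342₃`: fourth), a corner-free member with `η = |c_f|⁻¹` and bi-contractive bond variables:
`‖(Δ_U(h_□·O(h_□Λ)))(b)‖ ≤ B₀(1 + (d+1)((5∕8)(C1F∕M_h)(e^{δ}+1) + (25∕64)C2F∕M_h²))·e^{−δd(y,y′)}·|J|` for `b ∈ Δ(βy)`, `‖Λ‖ ≤ |J|`, `supp J ⊂ Δ(βy′)` — §1's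
expansion; the main term by (3.42)₄ at `h_□Λ`; per direction the first-order term at the neighbour `b⁻` by (3.42)₂ there (`e^{δ}`: one admissible bond), the first-order
term at `b` by (3.42)₂, the second-difference term by (3.42)₁; coefficients `κ₁L^{lev} ≤ (5∕8)C1F∕M_h`, `κ₂L^{2lev} ≤ (25∕64)C2F∕M_h²` since each non-zero coefficient
lies within one site of `supp h_□` (`lev ≤ j+1`).
[cite: Balaban1985BackgroundPropagators, (3.100) p.413, p.414 l.1–2, (3.23) p.395, Thm 3.3 p.399 with (3.42) p.397 (first, second and fourth members), (3.87) p.409; Balaban1984PropagatorsII, (2.44) p.230, p.234] -/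
theorem norm_lapB_hOh_le (c : ↥(cubes i.D.toDomains)) (hB₀ : 0 ≤ B₀) (hδ : 0 ≤ δ) (hη : etaS i = |i.cf|⁻¹)
    (ιB : BlkY i → IBondY i) (hι : ∀ s, β i.hN i.D i.hk (ιB s) = s)
    (hU : ∀ μ x, ‖(U μ x : 𝔸)‖ ≤ 1 ∧ ‖(((U μ x)⁻¹ : 𝔸ˣ) : 𝔸)‖ ≤ 1)
    (h342₀ : ∀ (J : FBondY i → ℝ) (y y' : IBondY i), (geo9K i).suppIn (Sum.inr J) y' →
      ∀ Λ : FBondY i → 𝔸, (∀ x, ‖Λ x‖ ≤ |J x|) → ∀ x : FBondY i, blkV1 i.hN i.D x = β i.hN i.D i.hk y →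
        ‖O Λ x‖ ≤ B₀ * (geo9K i).len y ^ 2 * Real.exp (-(δ * (geo9K i).dist y y')) * (geo9K i).supNorm (Sum.inr J))
    (h342₁ : ∀ (J : FBondY i → ℝ) (y y' : IBondY i), (geo9K i).suppIn (Sum.inr J) y' →
      ∀ Λ : FBondY i → 𝔸, (∀ x, ‖Λ x‖ ≤ |J x|) → ∀ (x : FBondY i) (ν : Fin (d + 1)), blkV1 i.hN i.D x = β i.hN i.D i.hk y →
        ‖cdB i U ν (O Λ) x‖ ≤ B₀ * (geo9K i).len y * Real.exp (-(δ * (geo9K i).dist y y')) * (geo9K i).supNorm (Sum.inr J))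
    (h342₃ : ∀ (J : FBondY i → ℝ) (y y' : IBondY i), (geo9K i).suppIn (Sum.inr J) y' →
      ∀ Λ : FBondY i → 𝔸, (∀ x, ‖Λ x‖ ≤ |J x|) → ∀ x : FBondY i, blkV1 i.hN i.D x = β i.hN i.D i.hk y →
        ‖lapB i U (O Λ) x‖ ≤ B₀ * Real.exp (-(δ * (geo9K i).dist y y')) * (geo9K i).supNorm (Sum.inr J))
    (J : FBondY i → ℝ) (y y' : IBondY i) (hs : (geo9K i).suppIn (Sum.inr J) y')
    (Λ : FBondY i → 𝔸) (hΛ : ∀ x, ‖Λ x‖ ≤ |J x|) (bd : FBondY i) (hb : blkV1 i.hN i.D bd = β i.hN i.D i.hk y) :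
    ‖lapB i U (cutMulY (hBdY i (hTY i c)) (O (cutMulY (hBdY i (hTY i c)) Λ))) bd‖
      ≤ B₀ * (1 + ((d : ℝ) + 1) * (5 / 8 * C1F d ℓ / i.Mh * (Real.exp δ + 1) + 25 / 64 * C2F d ℓ / i.Mh ^ 2))
          * Real.exp (-(δ * (geo9K i).dist y y')) * (geo9K i).supNorm (Sum.inr J) := by
  classical
  obtain ⟨_, hMh2, hR2, _⟩ := side_conditions i
  have hC1F : 0 ≤ C1F d ℓ := C1F_nonneg d ℓ
  have hC2F : 0 ≤ C2F d ℓ := C2F_nonneg d ℓ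
  have hL1 : (1 : ℝ) ≤ (ℓ : ℝ) + 1 := by linarith [(Nat.cast_nonneg ℓ : (0 : ℝ) ≤ ℓ)]
  have hMh0 : (0 : ℝ) < (i.Mh : ℝ) := by exact_mod_cast (B9GeoLemma21KLevelV1.one_le_Mh i)
  have hη0 : 0 < etaS i := etaS_pos i
  have hcf0 : 0 < |i.cf| := by
    have h := hη0; rw [hη] at h; exact inv_pos.1 h
  have hF0 : 0 ≤ (geo9K i).supNorm (Sum.inr J) := geo9K_supNorm_nonneg i _
  set E : ℝ := Real.exp (-(δ * (geo9K i).dist y y')) with hEdef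
  have hE0 : 0 ≤ E := (Real.exp_pos _).le
  have hE1 : E ≤ Real.exp δ * E := le_mul_of_one_le_left hE0 (Real.one_le_exp hδ)
  set F : ℝ := (geo9K i).supNorm (Sum.inr J) with hFdef
  -- the cut-off and the class
  set h : SiteY i → ℝ := hTY i c with hh
  have hh1 : ∀ x : FBondY i, |hBdY i h x| ≤ 1 := fun x =>
    abs_hT_le_one i.D (B9GeoLemma21KLevelV1.one_le_Mh i) (B9GeoLemma21KLevelV1.one_le_P i) c _
  have hΛ' : ∀ x, ‖cutMulY (𝔸 := 𝔸) (hBdY i h) Λ x‖ ≤ |J x| := norm_cutMulY_le_of_le hh1 hΛ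
  set A : FBondY i → 𝔸 := O (cutMulY (hBdY i h) Λ) with hA
  -- the chart point of the bond, its length
  set z : SiteY i := chartY i bd.src with hzdef
  have hbz : blkOf i.D.toDomains z = β i.hN i.D i.hk y := hb
  have hleny : (geo9K i).len y = ((ℓ : ℝ) + 1) ^ levY i z * etaS i := len_eq_pow_mul_eta i hη hbz
  have hcfl : |i.cf| * (geo9K i).len y = ((ℓ : ℝ) + 1) ^ levY i z := by rw [hleny, hη]; field_simp
  -- the coefficients
  set κ₁ : ℝ := C1F d ℓ / (8 / 5 * (bigSide ℓ i.Mh c.1.1 : ℝ)) with hκ₁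
  set κ₂ : ℝ := C2F d ℓ / (8 / 5 * (bigSide ℓ i.Mh c.1.1 : ℝ)) ^ 2 with hκ₂
  have hκ10 : 0 ≤ κ₁ := le_trans (abs_nonneg _) (abs_hTY_shiftY_sub_le i c 0 z)
  have hκ20 : 0 ≤ κ₂ := le_trans (abs_nonneg _) (abs_hTY_second_diff_le i c 0 z)
  -- touching points and their levels near `supp h_□`
  have htouchP : ∀ μ : Fin (d + 1), torusSupNorm (toKT i).NB (z.1 - (shiftY i μ z).1) ≤ 1 := fun μ => (torusSupNorm_sub_shiftY_le_one i μ z).1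
  have htouchM : ∀ μ : Fin (d + 1), torusSupNorm (toKT i).NB (z.1 - ((shiftY i μ).symm z).1) ≤ 1 := fun μ => (torusSupNorm_sub_shiftY_le_one i μ z).2
  have htouchP' : ∀ μ : Fin (d + 1), torusSupNorm (toKT i).NB ((shiftY i μ z).1 - z.1) ≤ 1 := fun μ => by
    simpa only [Equiv.symm_apply_apply] using (torusSupNorm_sub_shiftY_le_one i μ (shiftY i μ z)).2
  have htouchM' : ∀ μ : Fin (d + 1), torusSupNorm (toKT i).NB (((shiftY i μ).symm z).1 - z.1) ≤ 1 := fun μ => by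
    simpa only [Equiv.apply_symm_apply] using (torusSupNorm_sub_shiftY_le_one i μ ((shiftY i μ).symm z)).1
  -- `lev z ≤ j+1` as soon as one of `h(z)`, `h(z+e_μ)`, `h(z−e_μ)` is non-zero
  have hlevz : ∀ μ : Fin (d + 1), (h z ≠ 0 ∨ h (shiftY i μ z) ≠ 0 ∨ h ((shiftY i μ).symm z) ≠ 0) → levY i z ≤ c.1.1 + 1 := by
    rintro μ (h0 | h0 | h0)
    · exact (mem_QT_and_lev_of_near i c h0 (torusSupNorm_sub_self_le_one i z)).2
    · exact (mem_QT_and_lev_of_near i c h0 (htouchP μ)).2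
    · exact (mem_QT_and_lev_of_near i c h0 (htouchM μ)).2
  -- `lev (z−e_μ) ≤ j+1` as soon as one of `h(z)`, `h(z−e_μ)` is non-zero
  have hlevm : ∀ μ : Fin (d + 1), (h z ≠ 0 ∨ h ((shiftY i μ).symm z) ≠ 0) → levY i ((shiftY i μ).symm z) ≤ c.1.1 + 1 := by
    rintro μ (h0 | h0)
    · exact (mem_QT_and_lev_of_near i c h0 (htouchM' μ)).2
    · exact (mem_QT_and_lev_of_near i c h0 (torusSupNorm_sub_self_le_one i _)).2
  -- §1's expansion
  rw [lapB_cutMulY_apply]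
  -- the main term: (3.42)₄ through `|h_□(z)| ≤ 1`
  have T1 : ‖((h (chartY i bd.src) : ℝ) : ℂ) • lapB i U A bd‖ ≤ B₀ * E * F := by
    rw [norm_smul, Complex.norm_real, Real.norm_eq_abs]
    calc |h (chartY i bd.src)| * ‖lapB i U A bd‖ ≤ 1 * (B₀ * E * F) :=
          mul_le_mul (hh1 bd) (h342₃ J y y' hs _ hΛ' bd hb) (norm_nonneg _) zero_le_one
      _ = _ := one_mul _
  -- per direction: the three remainder terms
  have Tμ : ∀ μ : Fin (d + 1),
      ‖(((i.cf * (h (chartY i (bd.src.unshift μ)) - h (chartY i bd.src)) : ℝ) : ℂ) •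
              R (U μ (bd.src.unshift μ))⁻¹ (cdB i U μ A ⟨bd.src.unshift μ, bd.dir⟩)
            - ((i.cf * (h (chartY i (bd.src.shift μ)) - h (chartY i bd.src)) : ℝ) : ℂ) • cdB i U μ A bd
            - ((i.cf ^ 2 * (h (chartY i (bd.src.shift μ)) - 2 * h (chartY i bd.src) + h (chartY i (bd.src.unshift μ))) : ℝ) : ℂ) • A bd)‖
        ≤ B₀ * (5 / 8 * C1F d ℓ / i.Mh * (Real.exp δ + 1) + 25 / 64 * C2F d ℓ / i.Mh ^ 2) * E * F := by
    intro μ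
    have hzp : chartY i (bd.src.shift μ) = shiftY i μ z := (shiftY_chartY i μ bd.src).symm
    have hzm : chartY i (bd.src.unshift μ) = (shiftY i μ).symm z := (shiftY_symm_chartY i μ bd.src).symm
    -- the neighbour bond `b⁻` and its block
    set bm : FBondY i := ⟨bd.src.unshift μ, bd.dir⟩ with hbm
    set y₁ : IBondY i := ιB (blkV1 i.hN i.D bm) with hy₁
    have hb₁ : blkV1 i.hN i.D bm = β i.hN i.D i.hk y₁ := by rw [hy₁, hι]
    have hbz₁ : blkOf i.D.toDomains ((shiftY i μ).symm z) = β i.hN i.D i.hk y₁ := by rw [← hzm]; exact hb₁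
    have hleny₁ : (geo9K i).len y₁ = ((ℓ : ℝ) + 1) ^ levY i ((shiftY i μ).symm z) * etaS i := len_eq_pow_mul_eta i hη hbz₁
    have hcfl₁ : |i.cf| * (geo9K i).len y₁ = ((ℓ : ℝ) + 1) ^ levY i ((shiftY i μ).symm z) := by rw [hleny₁, hη]; field_simp
    have hdist : (geo9K i).dist y y' ≤ 1 + (geo9K i).dist y₁ y' := by
      rw [geo9K_dist_eq, geo9K_dist_eq, ← hbz, ← hbz₁]
      have hconn := connectedT (D := i.D) (B9GeoLemma21KLevelV1.one_le_Mh i) (B9GeoLemma21KLevelV1.one_le_P i)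
      have htri := hconn.dist_triangle (u := blkOf i.D.toDomains z) (v := blkOf i.D.toDomains ((shiftY i μ).symm z)) (w := β i.hN i.D i.hk y')
      have h1' := dist_blkOf_le_one_of_touch i (htouchM μ)
      have e : ((bondT i.D).dist (blkOf i.D.toDomains z) (β i.hN i.D i.hk y') : ℝ)
          ≤ ((bondT i.D).dist (blkOf i.D.toDomains z) (blkOf i.D.toDomains ((shiftY i μ).symm z)) : ℝ)
            + ((bondT i.D).dist (blkOf i.D.toDomains ((shiftY i μ).symm z)) (β i.hN i.D i.hk y') : ℝ) := by exact_mod_cast htri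
      have h1r : ((bondT i.D).dist (blkOf i.D.toDomains z) (blkOf i.D.toDomains ((shiftY i μ).symm z)) : ℝ) ≤ 1 := by exact_mod_cast h1'
      linarith
    have hexp : Real.exp (-(δ * (geo9K i).dist y₁ y')) ≤ Real.exp δ * E := by
      rw [hEdef, ← Real.exp_add]
      have := mul_le_mul_of_nonneg_left hdist hδ
      exact Real.exp_le_exp.2 (by linarith)
    -- (a) the first-order term at the neighbour `b⁻`
    have Ta : ‖((i.cf * (h (chartY i (bd.src.unshift μ)) - h (chartY i bd.src)) : ℝ) : ℂ) •
          R (U μ (bd.src.unshift μ))⁻¹ (cdB i U μ A bm)‖ ≤ B₀ * (5 / 8 * C1F d ℓ / i.Mh) * (Real.exp δ * E) * F := by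
      rw [norm_smul, Complex.norm_real, Real.norm_eq_abs, hzm, ← hzdef, abs_mul]
      have hval : ‖R (U μ (bd.src.unshift μ))⁻¹ (cdB i U μ A bm)‖ ≤ B₀ * (geo9K i).len y₁ * Real.exp (-(δ * (geo9K i).dist y₁ y')) * F :=
        (norm_R_le (hU μ _).2 (by rw [inv_inv]; exact (hU μ _).1) _).trans (h342₁ J y₁ y' hs _ hΛ' bm μ hb₁)
      by_cases h0 : h ((shiftY i μ).symm z) - h z = 0
      · rw [h0, abs_zero, mul_zero, zero_mul]; positivity
      · have hne : h z ≠ 0 ∨ h ((shiftY i μ).symm z) ≠ 0 := by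
          by_contra hc; push Not at hc; exact h0 (by rw [hc.1, hc.2, sub_zero])
        have hκ : κ₁ * ((ℓ : ℝ) + 1) ^ levY i ((shiftY i μ).symm z) ≤ 5 / 8 * C1F d ℓ / i.Mh := kappa_pow_le i c (hlevm μ hne)
        have hLip : |h ((shiftY i μ).symm z) - h z| ≤ κ₁ := abs_hTY_shiftY_symm_sub_le i c μ z
        calc |i.cf| * |h ((shiftY i μ).symm z) - h z| * ‖R (U μ (bd.src.unshift μ))⁻¹ (cdB i U μ A bm)‖
            ≤ |i.cf| * κ₁ * (B₀ * (geo9K i).len y₁ * Real.exp (-(δ * (geo9K i).dist y₁ y')) * F) :=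
              mul_le_mul (mul_le_mul_of_nonneg_left hLip hcf0.le) hval (norm_nonneg _) (mul_nonneg hcf0.le hκ10)
          _ = (κ₁ * (|i.cf| * (geo9K i).len y₁)) * B₀ * Real.exp (-(δ * (geo9K i).dist y₁ y')) * F := by ring
          _ ≤ (5 / 8 * C1F d ℓ / i.Mh) * B₀ * (Real.exp δ * E) * F := by
              rw [hcfl₁]
              refine mul_le_mul_of_nonneg_right ?_ hF0
              exact mul_le_mul (mul_le_mul_of_nonneg_right hκ hB₀) hexp (Real.exp_pos _).le (mul_nonneg (by positivity) hB₀)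
          _ = _ := by ring
    -- (b) the first-order term at `b`
    have Tb : ‖((i.cf * (h (chartY i (bd.src.shift μ)) - h (chartY i bd.src)) : ℝ) : ℂ) • cdB i U μ A bd‖
        ≤ B₀ * (5 / 8 * C1F d ℓ / i.Mh) * E * F := by
      rw [norm_smul, Complex.norm_real, Real.norm_eq_abs, hzp, ← hzdef, abs_mul]
      have hval : ‖cdB i U μ A bd‖ ≤ B₀ * (geo9K i).len y * E * F := h342₁ J y y' hs _ hΛ' bd μ hb
      by_cases h0 : h (shiftY i μ z) - h z = 0
      · rw [h0, abs_zero, mul_zero, zero_mul]; positivity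
      · have hne : h z ≠ 0 ∨ h (shiftY i μ z) ≠ 0 ∨ h ((shiftY i μ).symm z) ≠ 0 := by
          by_contra hc; push Not at hc; exact h0 (by rw [hc.1, hc.2.1, sub_zero])
        have hκ : κ₁ * ((ℓ : ℝ) + 1) ^ levY i z ≤ 5 / 8 * C1F d ℓ / i.Mh := kappa_pow_le i c (hlevz μ hne)
        have hLip : |h (shiftY i μ z) - h z| ≤ κ₁ := abs_hTY_shiftY_sub_le i c μ z
        calc |i.cf| * |h (shiftY i μ z) - h z| * ‖cdB i U μ A bd‖
            ≤ |i.cf| * κ₁ * (B₀ * (geo9K i).len y * E * F) :=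
              mul_le_mul (mul_le_mul_of_nonneg_left hLip hcf0.le) hval (norm_nonneg _) (mul_nonneg hcf0.le hκ10)
          _ = (κ₁ * (|i.cf| * (geo9K i).len y)) * B₀ * E * F := by ring
          _ ≤ (5 / 8 * C1F d ℓ / i.Mh) * B₀ * E * F := by
              rw [hcfl]
              exact mul_le_mul_of_nonneg_right (mul_le_mul_of_nonneg_right (mul_le_mul_of_nonneg_right hκ hB₀) hE0) hF0
          _ = _ := by ring
    -- (c) the second-difference term
    have Tc : ‖((i.cf ^ 2 * (h (chartY i (bd.src.shift μ)) - 2 * h (chartY i bd.src) + h (chartY i (bd.src.unshift μ))) : ℝ) : ℂ) • A bd‖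
        ≤ B₀ * (25 / 64 * C2F d ℓ / i.Mh ^ 2) * E * F := by
      rw [norm_smul, Complex.norm_real, Real.norm_eq_abs, hzp, hzm, ← hzdef, abs_mul, abs_pow]
      have hval : ‖A bd‖ ≤ B₀ * (geo9K i).len y ^ 2 * E * F := h342₀ J y y' hs _ hΛ' bd hb
      by_cases h0 : h (shiftY i μ z) - 2 * h z + h ((shiftY i μ).symm z) = 0
      · rw [h0, abs_zero, mul_zero, zero_mul]; positivity
      · have hne : h z ≠ 0 ∨ h (shiftY i μ z) ≠ 0 ∨ h ((shiftY i μ).symm z) ≠ 0 := by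
          by_contra hc; push Not at hc; exact h0 (by rw [hc.1, hc.2.1, hc.2.2]; ring)
        have hκ : κ₂ * (((ℓ : ℝ) + 1) ^ levY i z) ^ 2 ≤ 25 / 64 * C2F d ℓ / i.Mh ^ 2 := kappa2_pow_le i c (hlevz μ hne)
        have hLip : |h (shiftY i μ z) - 2 * h z + h ((shiftY i μ).symm z)| ≤ κ₂ := abs_hTY_second_diff_le i c μ z
        calc |i.cf| ^ 2 * |h (shiftY i μ z) - 2 * h z + h ((shiftY i μ).symm z)| * ‖A bd‖
            ≤ |i.cf| ^ 2 * κ₂ * (B₀ * (geo9K i).len y ^ 2 * E * F) :=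
              mul_le_mul (mul_le_mul_of_nonneg_left hLip (by positivity)) hval (norm_nonneg _) (mul_nonneg (by positivity) hκ20)
          _ = (κ₂ * (|i.cf| * (geo9K i).len y) ^ 2) * B₀ * E * F := by ring
          _ ≤ (25 / 64 * C2F d ℓ / i.Mh ^ 2) * B₀ * E * F := by
              rw [hcfl]
              exact mul_le_mul_of_nonneg_right (mul_le_mul_of_nonneg_right (mul_le_mul_of_nonneg_right hκ hB₀) hE0) hF0
          _ = _ := by ring
    calc _ ≤ ‖((i.cf * (h (chartY i (bd.src.unshift μ)) - h (chartY i bd.src)) : ℝ) : ℂ) • R (U μ (bd.src.unshift μ))⁻¹ (cdB i U μ A bm)‖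
          + ‖((i.cf * (h (chartY i (bd.src.shift μ)) - h (chartY i bd.src)) : ℝ) : ℂ) • cdB i U μ A bd‖
          + ‖((i.cf ^ 2 * (h (chartY i (bd.src.shift μ)) - 2 * h (chartY i bd.src) + h (chartY i (bd.src.unshift μ))) : ℝ) : ℂ) • A bd‖ :=
          (norm_sub_le _ _).trans (add_le_add (norm_sub_le _ _) le_rfl)
      _ ≤ B₀ * (5 / 8 * C1F d ℓ / i.Mh) * (Real.exp δ * E) * F + B₀ * (5 / 8 * C1F d ℓ / i.Mh) * E * F
          + B₀ * (25 / 64 * C2F d ℓ / i.Mh ^ 2) * E * F := add_le_add (add_le_add Ta Tb) Tc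
      _ = _ := by ring
  -- assemble
  have hsum : ‖∑ μ : Fin (d + 1),
        (((i.cf * (h (chartY i (bd.src.unshift μ)) - h (chartY i bd.src)) : ℝ) : ℂ) •
              R (U μ (bd.src.unshift μ))⁻¹ (cdB i U μ A ⟨bd.src.unshift μ, bd.dir⟩)
            - ((i.cf * (h (chartY i (bd.src.shift μ)) - h (chartY i bd.src)) : ℝ) : ℂ) • cdB i U μ A bd
            - ((i.cf ^ 2 * (h (chartY i (bd.src.shift μ)) - 2 * h (chartY i bd.src) + h (chartY i (bd.src.unshift μ))) : ℝ) : ℂ) • A bd)‖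
      ≤ ((d : ℝ) + 1) * (B₀ * (5 / 8 * C1F d ℓ / i.Mh * (Real.exp δ + 1) + 25 / 64 * C2F d ℓ / i.Mh ^ 2) * E * F) := by
    refine (norm_sum_le _ _).trans ?_
    calc _ ≤ ∑ μ : Fin (d + 1), B₀ * (5 / 8 * C1F d ℓ / i.Mh * (Real.exp δ + 1) + 25 / 64 * C2F d ℓ / i.Mh ^ 2) * E * F := Finset.sum_le_sum fun μ _ => Tμ μ
      _ = _ := by rw [Finset.sum_const, Finset.card_univ, Fintype.card_fin, nsmul_eq_mul]; push_cast; ring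
  calc _ ≤ ‖((h (chartY i bd.src) : ℝ) : ℂ) • lapB i U A bd‖ + ‖∑ μ : Fin (d + 1),
        (((i.cf * (h (chartY i (bd.src.unshift μ)) - h (chartY i bd.src)) : ℝ) : ℂ) •
              R (U μ (bd.src.unshift μ))⁻¹ (cdB i U μ A ⟨bd.src.unshift μ, bd.dir⟩)
            - ((i.cf * (h (chartY i (bd.src.shift μ)) - h (chartY i bd.src)) : ℝ) : ℂ) • cdB i U μ A bd
            - ((i.cf ^ 2 * (h (chartY i (bd.src.shift μ)) - 2 * h (chartY i bd.src) + h (chartY i (bd.src.unshift μ))) : ℝ) : ℂ) • A bd)‖ :=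
        norm_add_le _ _
    _ ≤ B₀ * E * F + ((d : ℝ) + 1) * (B₀ * (5 / 8 * C1F d ℓ / i.Mh * (Real.exp δ + 1) + 25 / 64 * C2F d ℓ / i.Mh ^ 2) * E * F) := add_le_add T1 hsum
    _ = _ := by ring

end Lap

/-! ## §3 Localisation; the block majorant of the conjugated Laplacian term (FILE 2-B's `hTL □` at `GACubeY`) and its sum over the cover (`hKL`) -/

section Support

variable (U : CfgY 𝔸 i)

/-- if `h` vanishes at `b₋` and at all `b₋ ± e_μ`, then `(Δ_U(hΨ))(b) = 0`. [cite: Balaban1985BackgroundPropagators, (3.100) p.413, bookkeeping] -/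
theorem lapB_hMul_apply_eq_zero_of_far (h : SiteY i → ℝ) (Ψ : FBondY i → 𝔸) (bd : FBondY i)
    (h0 : h (chartY i bd.src) = 0) (hp : ∀ μ : Fin (d + 1), h (chartY i (bd.src.shift μ)) = 0) (hm : ∀ μ : Fin (d + 1), h (chartY i (bd.src.unshift μ)) = 0) :
    lapB i U (cutMulY (hBdY i h) Ψ) bd = 0 := by
  rw [lapB_cutMulY_apply, h0, Complex.ofReal_zero, zero_smul, zero_add]
  refine Finset.sum_eq_zero fun μ _ => ?_
  rw [hp μ, hm μ]
  simp

/-- **LOCALISATION OF THE LAPLACIAN CUBE TERM**: if `(Δ_U(h_□Ψ))(b) ≠ 0` then `Δ(b)` is within one admissible bond of a block of `QT □`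
(`supp h_□ ⊂ QT □`: `blkOf_mem_QT_of_hT_ne_zero`; touching blocks: `dist_blkOf_le_one_of_touch`) — inside FILE 3-B's localisation set (radius `2L+4`).
[cite: Balaban1985BackgroundPropagators, (3.100) p.413, (3.87) p.409; Balaban1984PropagatorsII, p.235, (2.46) p.231] -/
theorem exists_nearQT_of_lapB_hOh_ne_zero (c : ↥(cubes i.D.toDomains)) (Ψ : FBondY i → 𝔸) (bd : FBondY i)
    (hne : lapB i U (cutMulY (hBdY i (hTY i c)) Ψ) bd ≠ 0) :
    ∃ yq ∈ QT i.D (B9GeoLemma21KLevelV1.one_le_Mh i) (four_le_P' i) c,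
      (((bondT i.D).dist (blkV1 i.hN i.D bd) yq : ℕ) : ℝ) ≤ 2 * (ℓ : ℝ) + 6 := by
  obtain ⟨_, hMh2, hR2, _⟩ := side_conditions i
  have hℓ1 : (1 : ℝ) ≤ 2 * (ℓ : ℝ) + 6 := by linarith [(Nat.cast_nonneg ℓ : (0 : ℝ) ≤ ℓ)]
  -- a point `p` with `h_□(p) ≠ 0` within one site of `z = b₋`
  have key : ∀ p : SiteY i, hTY i c p ≠ 0 → torusSupNorm (toKT i).NB ((chartY i bd.src).1 - p.1) ≤ 1 →
      ∃ yq ∈ QT i.D (B9GeoLemma21KLevelV1.one_le_Mh i) (four_le_P' i) c, (((bondT i.D).dist (blkV1 i.hN i.D bd) yq : ℕ) : ℝ) ≤ 2 * (ℓ : ℝ) + 6 := by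
    intro p hp ht
    refine ⟨blkOf i.D.toDomains p, blkOf_mem_QT_of_hT_ne_zero hMh2 hR2 (four_le_P' i) c hp, ?_⟩
    have h1' := dist_blkOf_le_one_of_touch i ht
    have h1r : (((bondT i.D).dist (blkOf i.D.toDomains (chartY i bd.src)) (blkOf i.D.toDomains p) : ℕ) : ℝ) ≤ 1 := by exact_mod_cast h1'
    exact h1r.trans hℓ1
  by_cases h0 : hTY i c (chartY i bd.src) = 0
  · by_cases hp : ∀ μ : Fin (d + 1), hTY i c (chartY i (bd.src.shift μ)) = 0
    · have hm : ¬ ∀ μ : Fin (d + 1), hTY i c (chartY i (bd.src.unshift μ)) = 0 := fun hm =>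
        hne (lapB_hMul_apply_eq_zero_of_far i U (hTY i c) Ψ bd h0 hp hm)
      push Not at hm
      obtain ⟨μ, hμ⟩ := hm
      rw [← shiftY_symm_chartY] at hμ
      exact key _ hμ (torusSupNorm_sub_shiftY_le_one i μ (chartY i bd.src)).2
    · push Not at hp
      obtain ⟨μ, hμ⟩ := hp
      rw [← shiftY_chartY] at hμ
      exact key _ hμ (torusSupNorm_sub_shiftY_le_one i μ (chartY i bd.src)).1
  · exact key _ h0 (torusSupNorm_sub_self_le_one i _)

end Support

section Majorant

variable [Fintype (geo9K i).Site] {Rr : ℝ} {Hp : Prop}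
variable (ιB : BlkY i → IBondY i)
variable {B : B9.Backgrounds} (cfg : B.Cfg → CfgY 𝔸 i) (par : BondParY 𝔸 i) {U₁ : B.Cfg}

/-- ★★ **THE `hTL □` INPUT OF FILE 2-B AT THE CUBE LETTER `G_□(U) = GACubeY`, FROM ITS (3.42) BLOCK OVER THE CLASS**: for any ℝ-linear `L` agreeing pointwise with `Δ_U`
at `U = cfg U₁`, `conj b(L)·(h_□·conj b G_□(U)·h_□)` has the localized block majorant `1_{S′_□}(a)·M₂(Σ‖b_j‖)·B₀(1 + (d+1)((5∕8)(C1F∕M_h)(e^{δ}+1) + (25∕64)C2F∕M_h²))·e^{−δd(a,a′)}`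
on FILE 3-B's sets `S′_□ = {a : ∃ y ∈ QT □, d_T(βa, y) ≤ 2L+4}`. [cite: Balaban1985BackgroundPropagators, (3.100) p.413, p.414 l.1–2, Thm 3.3 (3.42)₄ pp.397–399, (3.87) p.409] -/
theorem hasMajorant_conj_lapTermB (hι : ∀ s, β i.hN i.D i.hk (ιB s) = s)
    {M₂ : ℝ} (hM₂ : 0 ≤ M₂) (hrepr : ∀ (v : 𝔸) (j : ι), |b.repr v j| ≤ M₂ * ‖v‖) (hη : etaS i = |i.cf|⁻¹)
    (parS : SiteParY 𝔸 i) (parB : BondParY 𝔸 i) {B₀ δ : ℝ} (hB₀ : 0 ≤ B₀) (hδ : 0 ≤ δ)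
    (c : ↥(cubes i.D.toDomains)) (hE : EBlock (kernelFamilyBInv i B cfg (GACubeY i c parS parB) par) B₀ δ U₁)
    (hU : ∀ μ x, ‖(cfg U₁ μ x : 𝔸)‖ ≤ 1 ∧ ‖(((cfg U₁ μ x)⁻¹ : 𝔸ˣ) : 𝔸)‖ ≤ 1)
    (Lp : Module.End ℝ (FBondY i → 𝔸)) (hLp : ∀ Λ, Lp Λ = lapB i (cfg U₁) Λ) :
    HasMajorant (g := toB6 (geo9K i) Rr Hp) (fun p : FBondY i × ι => ιB (blkV1 i.hN i.D p.1))
      (conj b Lp * (mulOp (fun p : FBondY i × ι => hBdY i (hTY i c) p.1) * conj b ((GACubeY i c parS parB (cfg U₁)).restrictScalars ℝ) *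
        mulOp (fun p : FBondY i × ι => hBdY i (hTY i c) p.1)))
      (fun a a' => if (∃ y ∈ QT i.D (B9GeoLemma21KLevelV1.one_le_Mh i) (four_le_P' i) c,
          (((bondT i.D).dist (β i.hN i.D i.hk a) y : ℕ) : ℝ) ≤ 2 * (ℓ : ℝ) + 6)
        then M₂ * (∑ j, ‖b j‖) * (B₀ * (1 + ((d : ℝ) + 1) * (5 / 8 * C1F d ℓ / i.Mh * (Real.exp δ + 1) + 25 / 64 * C2F d ℓ / i.Mh ^ 2)))
          * Real.exp (-(δ * (geo9K i).dist a a')) else 0) := by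
  classical
  -- the operator as ONE conjugated ℝ-linear letter
  set Rl : Module.End ℝ (FBondY i → 𝔸) := Lp * ((cutMulY (𝔸 := 𝔸) (hBdY i (hTY i c))).restrictScalars ℝ *
    (GACubeY i c parS parB (cfg U₁)).restrictScalars ℝ * (cutMulY (𝔸 := 𝔸) (hBdY i (hTY i c))).restrictScalars ℝ) with hRl
  have hRl_apply : ∀ Λ, Rl Λ = lapB i (cfg U₁) (cutMulY (hBdY i (hTY i c)) (GACubeY i c parS parB (cfg U₁) (cutMulY (hBdY i (hTY i c)) Λ))) :=
    fun Λ => by simp only [hRl, Module.End.mul_apply, LinearMap.restrictScalars_apply, hLp]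
  have hconj : conj b Rl = conj b Lp * (mulOp (fun p : FBondY i × ι => hBdY i (hTY i c) p.1) *
      conj b ((GACubeY i c parS parB (cfg U₁)).restrictScalars ℝ) * mulOp (fun p : FBondY i × ι => hBdY i (hTY i c) p.1)) := by
    rw [hRl, B9Eq352DivFormLetters.conj_mul, B9Eq352DivFormLetters.conj_mul, B9Eq352DivFormLetters.conj_mul, conj_cutMulY]
  rw [← hconj]
  have hT : ∀ (cx : ℂ) (Λ : FBondY i → 𝔸), Rl (cx • Λ) = cx • Rl Λ := fun cx Λ => by
    rw [hRl_apply, hRl_apply, map_smul, map_smul, map_smul, ← lapBC_apply, ← lapBC_apply, map_smul]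
  have hC1F : 0 ≤ C1F d ℓ := C1F_nonneg d ℓ
  have hC2F : 0 ≤ C2F d ℓ := C2F_nonneg d ℓ
  have hA₀ : 0 ≤ B₀ * (1 + ((d : ℝ) + 1) * (5 / 8 * C1F d ℓ / i.Mh * (Real.exp δ + 1) + 25 / 64 * C2F d ℓ / i.Mh ^ 2)) := mul_nonneg hB₀ (by positivity)
  have hW0 : ∀ a a' : IBondY i, 0 ≤ (if (∃ y ∈ QT i.D (B9GeoLemma21KLevelV1.one_le_Mh i) (four_le_P' i) c,
        (((bondT i.D).dist (β i.hN i.D i.hk a) y : ℕ) : ℝ) ≤ 2 * (ℓ : ℝ) + 6)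
      then (B₀ * (1 + ((d : ℝ) + 1) * (5 / 8 * C1F d ℓ / i.Mh * (Real.exp δ + 1) + 25 / 64 * C2F d ℓ / i.Mh ^ 2))) * Real.exp (-(δ * (geo9K i).dist a a'))
      else 0) := fun a a' => ite_nonneg (mul_nonneg hA₀ (Real.exp_nonneg _)) le_rfl
  refine hasMajorant_mono (g := toB6 (geo9K i) Rr Hp) _
    (hasMajorant_conj_of_ball_boundB i b (Rr := Rr) (Hp := Hp) Rl hT ιB hι hM₂ hrepr _ hW0 fun J y y' hs E hE1 x hx => ?_)
    fun a a' => le_of_eq ?_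
  · rw [hRl_apply]
    by_cases hmem : ∃ yq ∈ QT i.D (B9GeoLemma21KLevelV1.one_le_Mh i) (four_le_P' i) c,
        (((bondT i.D).dist (β i.hN i.D i.hk y) yq : ℕ) : ℝ) ≤ 2 * (ℓ : ℝ) + 6
    · rw [if_pos hmem]
      exact norm_lapB_hOh_le i (cfg U₁) (GACubeY i c parS parB (cfg U₁)) c hB₀ hδ hη ιB hι hU
        (h342₀_of_eBlockInvB i b cfg (GACubeY i c parS parB) par hE hM₂ hrepr)
        (h342₁_of_eBlockInvB i b cfg (GACubeY i c parS parB) par hE hM₂ hrepr)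
        (h342₃_of_eBlockInvB i b cfg (GACubeY i c parS parB) par hE hM₂ hrepr) J y y' hs (liftY J E) (norm_liftY_le_abs i J hE1) x hx
    · rw [if_neg hmem, zero_mul]
      refine le_of_eq (norm_eq_zero.2 ?_)
      by_contra hne
      obtain ⟨yq, hyq, hdq⟩ := exists_nearQT_of_lapB_hOh_ne_zero i (cfg U₁) c _ x hne
      rw [hx] at hdq
      exact hmem ⟨yq, hyq, hdq⟩
  · by_cases h : ∃ yq ∈ QT i.D (B9GeoLemma21KLevelV1.one_le_Mh i) (four_le_P' i) c,
        (((bondT i.D).dist (β i.hN i.D i.hk a) yq : ℕ) : ℝ) ≤ 2 * (ℓ : ℝ) + 6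
    · rw [if_pos h, if_pos h]; ring
    · rw [if_neg h, if_neg h, mul_zero]

omit [CompleteSpace 𝔸] in
/-- ★★ **THE `hKL` BOUND OF FILE 2-B AT THE COVER OF RECORD**: the localized majorants of `hasMajorant_conj_lapTermB` summed over the cubes with FILE 3-B's overlap count
`N′ = 3·5^{d+1}e^{αδ(2L+4)}c₁(α)`: `Σ_□ K_{L,□}(a,a′) ≤ N′·M₂(Σ‖b_j‖)·B₀(1 + (d+1)(…))·1·e^{−δd(a,a′)}` — the `A₃` of FILE 2-B (written with the factor `1` of its `hKL` slot).
[cite: Balaban1985BackgroundPropagators, (3.87) p.409, Thm 3.3 (3.42)₄ p.397; Balaban1984PropagatorsII, p.232, Lemma 2.1 (2.61) p.234, p.235] -/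
theorem sum_lapTermB_majorant_le (hι : ∀ s, β i.hN i.D i.hk (ιB s) = s) {M₂ : ℝ} (hM₂ : 0 ≤ M₂) {B₀ δ : ℝ} (hB₀ : 0 ≤ B₀)
    (d' : ℕ) {α : ℝ} (hαδ : 0 ≤ α * δ) (h261 : Ineq261 d' (toB6 (geo9K i) Rr Hp) δ α) (a a' : IBondY i) :
    (∑ c : ↥(cubes i.D.toDomains),
        (if (∃ y ∈ QT i.D (B9GeoLemma21KLevelV1.one_le_Mh i) (four_le_P' i) c,
            (((bondT i.D).dist (β i.hN i.D i.hk a) y : ℕ) : ℝ) ≤ 2 * (ℓ : ℝ) + 6)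
          then M₂ * (∑ j, ‖b j‖) * (B₀ * (1 + ((d : ℝ) + 1) * (5 / 8 * C1F d ℓ / i.Mh * (Real.exp δ + 1) + 25 / 64 * C2F d ℓ / i.Mh ^ 2)))
            * Real.exp (-(δ * (geo9K i).dist a a')) else 0)) ≤
      (3 * 5 ^ (d + 1) * (Real.exp (α * δ * (2 * (ℓ : ℝ) + 6)) * B6.c1 d' δ α)) *
          (M₂ * (∑ j, ‖b j‖) * (B₀ * (1 + ((d : ℝ) + 1) * (5 / 8 * C1F d ℓ / i.Mh * (Real.exp δ + 1) + 25 / 64 * C2F d ℓ / i.Mh ^ 2)))) * 1 *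
        Real.exp (-(δ * (geo9K i).dist a a')) := by
  classical
  have hC1F : 0 ≤ C1F d ℓ := C1F_nonneg d ℓ
  have hC2F : 0 ≤ C2F d ℓ := C2F_nonneg d ℓ
  have hSb : 0 ≤ ∑ j, ‖b j‖ := Finset.sum_nonneg fun _ _ => norm_nonneg _
  have hK0 : 0 ≤ M₂ * (∑ j, ‖b j‖) * (B₀ * (1 + ((d : ℝ) + 1) * (5 / 8 * C1F d ℓ / i.Mh * (Real.exp δ + 1) + 25 / 64 * C2F d ℓ / i.Mh ^ 2)))
      * Real.exp (-(δ * (geo9K i).dist a a')) :=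
    mul_nonneg (mul_nonneg (mul_nonneg hM₂ hSb) (mul_nonneg hB₀ (by positivity))) (Real.exp_nonneg _)
  have hterm : ∀ c : ↥(cubes i.D.toDomains),
      (if (∃ y ∈ QT i.D (B9GeoLemma21KLevelV1.one_le_Mh i) (four_le_P' i) c,
            (((bondT i.D).dist (β i.hN i.D i.hk a) y : ℕ) : ℝ) ≤ 2 * (ℓ : ℝ) + 6)
          then M₂ * (∑ j, ‖b j‖) * (B₀ * (1 + ((d : ℝ) + 1) * (5 / 8 * C1F d ℓ / i.Mh * (Real.exp δ + 1) + 25 / 64 * C2F d ℓ / i.Mh ^ 2)))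
            * Real.exp (-(δ * (geo9K i).dist a a')) else 0) =
      (if (∃ y ∈ QT i.D (B9GeoLemma21KLevelV1.one_le_Mh i) (four_le_P' i) c,
          (((bondT i.D).dist (β i.hN i.D i.hk a) y : ℕ) : ℝ) ≤ 2 * (ℓ : ℝ) + 6) then (1 : ℝ) else 0) *
        (M₂ * (∑ j, ‖b j‖) * (B₀ * (1 + ((d : ℝ) + 1) * (5 / 8 * C1F d ℓ / i.Mh * (Real.exp δ + 1) + 25 / 64 * C2F d ℓ / i.Mh ^ 2)))
          * Real.exp (-(δ * (geo9K i).dist a a'))) := by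
    intro c
    by_cases h : ∃ y ∈ QT i.D (B9GeoLemma21KLevelV1.one_le_Mh i) (four_le_P' i) c,
        (((bondT i.D).dist (β i.hN i.D i.hk a) y : ℕ) : ℝ) ≤ 2 * (ℓ : ℝ) + 6
    · rw [if_pos h, if_pos h, one_mul]
    · rw [if_neg h, if_neg h, zero_mul]
  rw [Finset.sum_congr rfl fun c _ => hterm c, ← Finset.sum_mul]
  refine (mul_le_mul_of_nonneg_right (sum_indicator_nearQT_le i ιB hι d' hαδ h261 a) hK0).trans (le_of_eq ?_)
  ring

end Majorant

end Literature.MathematicalPhysics.QuantumFieldTheory.Balaban1983to89.B9Thm310CutoffLapTermsB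

end
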